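import Summits.QuantumFields.BalabanUV.T4Continuum.Support.NE3NestedMeanBlockOperator
import Summits.QuantumFields.BalabanUV.T4Continuum.Support.NE3SquaredTentBump
import HarnessLib

/-!
# NE7SquaredBumpNestedMeanOperator — THE NESTED-MEAN BLOCK OPERATOR OF THE DRESSED **SQUARED**-TENT BUMP: the constant-coefficient dressed bump `cbump2W M W X`
# (profile `tent²`, `C¹` across the block faces), its EXACT single-scale transported mean `tentMean2 • X`, and the near-scalar operator `Kop2_z`
# with `‖Kop2 X‖ ≤ E_j·tentMean2·‖X‖` (file 114 of the curved (APE), F184; first brick of (T1♯))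

Cell `pub-balaban`, rung (B)+1 sub-cell t4, lineage `b2b-balaban-t4-ne7-p1` (CRUX PROVER NE7 #1 = OWNER of row NE7), generation 84; memo
`t4/b2b-balaban-t4-ne7-p1-g84/SCALAR-ROWS.md` §3.  The `tent²` TWIN of row NE3's leaf-01-g6 file `NE3NestedMeanBlockOperator` (§2–§3 there, profile `tent`), over its §1
(`bmeanIterW_congr_block`, `bmeanIterW_add_period'`, `star_bmeanIterW`), `NE3DressedBlockField` (`dressW`, `bmeanW_dressW`), `NE3SquaredTentBump` (`bump2`, `tentSum2`,
`sum_block_bump2`, `bump2_add_period`) and NE3-R2's bridge `NE3NestedBlockMeanBridge.norm_bmeanIterW_sub_bmeanW_le` BY NAME.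
WHY.  (T1♯) of F182∕F183 asks for an EXACT right inverse of the nested transported block mean `bmeanIterW L (j+1) W` with sup `C_a` and COVARIANT-LAPLACIAN sup `C_a′ ≍ 1∕M²`.
Row NE3's nested-mean fix (`NE3CompetitorNestedFix.nfixW`, profile `tent`) is exact and sup-bounded but `C⁰` at the block faces (second differences `≍ 1∕M` there); the
squared profile `tent²` is `C¹` across the faces (`NE3SquaredTentProfile.abs_tentSq_sdiff_le`, `NE3SquaredTentBump.norm_sdiff_bump2_le`: `O(1∕M²)` everywhere).  This file
is the operator side of the squared fix (sequel: the per-block near-scalar solve, then the covariant Laplacian at the curved background).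
WHAT ([folklore]; 0 sorry; DATA defs `cbump2W`, `tentMean2`, `Kop2` → definition lane):
§1 `cbump2W M W X := dressW M W (bump2 M (fun _ => X))`: `cbump2W_apply`, additivity, real homogeneity, `star`-equivariance, `norm_cbump2W` (`= tent²·‖X‖ ≤ ‖X‖`),
   `dressW_bump2_block`, `cbump2W_add_period`;
§2 `tentMean2 d M := tentSum2 d M ∕ M^d` (`64^{−d} ≤ tentMean2 ≤ 1`), **`bmeanW_cbump2W`** (the single-scale part is EXACT: `= tentMean2 • X`);
§3 **`Kop2 L j W z`** (`X ↦ bmeanIterW L (j+1) W (cbump2W M W X) z − tentMean2 • X`, ℝ-linear): `Kop2_eq_sub_bmeanW`, **`norm_Kop2_le`** (`≤ E_j·tentMean2·‖X‖`,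
   `E_j = 4d²(M−1)²x + 16d·loopRad(d,L,r_j)`), `star_Kop2`, `Kop2_add_period`.
HONEST FRAMING (page 1): bookkeeping kinematics at one background of the multi-level small-field class; nothing of Bałaban's asserted; (T1♯), (APE) on curved data NOT proved
here; NOT ONE-STEP, NOT NE7; spine 0∕9; finite T⁴ rung (B)+1 — NOT infinite volume, NOT mass gap, NOT `BetaPertH`, NOT Clay.  Continuum YM on T⁴ ⇐ BetaPertH ∧ nine spine
estimates (0/9 proved); BetaPertH ⇐ (D1) ∧ (D4) ∧ CAP+tail; G-an2-4 gates asym, D1 and NE2/3/4.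
-/

set_option autoImplicit false

open scoped BigOperators Matrix.Norms.L2Operator
open Finset

namespace Summit.QuantumFields.BalabanUV.T4Continuum.NE7SquaredBumpNestedMeanOperator

open Literature.MathematicalPhysics.QuantumFieldTheory.Balaban1983to89
open B7Prop1Explicit B7Prop2Explicit
open T4AveragingDeficitWall (IsUnitaryCfg SmallField Ad)
open T4AveragingDeficitWallBoundary (periodBox mem_periodBox card_periodBox IsPeriodicCfg)
open AveragingDeficitTransport (norm_Ad_of_unitary Ad_mem_skewAdjoint)
open AveragingDeficitNearIdentity (Ad_add Ad_real_smul)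
open AveragingDeficitTwoLevelPrep (prop1Radius)
open AveragingDeficitMultiLevelPrep (tower LevelSmall)
open AveragingDeficitBlockDensity (btree btree_mem)
open NE3CovariantBlockMean (bmeanW bmeanIterW)
open NE3FrameFreeSliceW (bmeanIterW_add bmeanIterW_smul)
open NE3CurvedProjectedLandau (tower_eq_pow_mul)
open NE3DressedBlockField (dressW dressW_add_period bmeanW_dressW)
open NE3TentBump (tent tent_nonneg tent_le_one)
open NE3SquaredTentBump (tentSum2 le_tentSum2 tentSum2_pos bump2 sum_block_bump2 sum_block_tentSq bump2_add_period)
open NE3CoarseInterpolant (blk_block)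
open NE3NestedBlockMeanBridge (norm_bmeanIterW_sub_bmeanW_le)
open NE3NestedMeanBlockOperator (bmeanIterW_add_period' star_Ad_of_unitary star_bmeanIterW)
open SpreadLift (loopRad)

noncomputable section

variable {d : ℕ} {n : Type*} [Fintype n] [DecidableEq n]

/-! ## §1 The constant-coefficient dressed squared-tent bump -/

/-- THE CONSTANT-COEFFICIENT DRESSED SQUARED-TENT BUMP: `dressW M W (bump2 M (fun _ => X))`. [folklore] -/
def cbump2W (M : ℕ) (W : Site d → Fin d → (Matrix n n ℂ)ˣ) (X : Matrix n n ℂ) : Site d → Matrix n n ℂ :=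
  dressW M W (bump2 M (fun _ => X))

/-- Pointwise formula: `cbump2W M W X y = (tent M y)² • Ad (btree …)⁻¹ X`. [folklore] -/
theorem cbump2W_apply (M : ℕ) (W : Site d → Fin d → (Matrix n n ℂ)ˣ) (X : Matrix n n ℂ) (y : Site d) :
    cbump2W M W X y = (tent M y ^ 2) • Ad (btree M W (SkeletonLattice.cdiv M y) y)⁻¹ X := by
  simp only [cbump2W, dressW, bump2, Ad_real_smul]

/-- Additivity in the coefficient. [folklore] -/
theorem cbump2W_add (M : ℕ) (W : Site d → Fin d → (Matrix n n ℂ)ˣ) (X Y : Matrix n n ℂ) :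
    cbump2W M W (X + Y) = cbump2W M W X + cbump2W M W Y := by
  funext y; simp only [cbump2W_apply, Pi.add_apply, Ad_add, smul_add]

/-- Real homogeneity in the coefficient. [folklore] -/
theorem cbump2W_smul (M : ℕ) (W : Site d → Fin d → (Matrix n n ℂ)ˣ) (r : ℝ) (X : Matrix n n ℂ) :
    cbump2W M W (r • X) = r • cbump2W M W X := by
  funext y; simp only [cbump2W_apply, Pi.smul_apply, Ad_real_smul, smul_comm (tent M y ^ 2) r]

/-- `star`-equivariance at a unitary background. [folklore] -/
theorem star_cbump2W (M : ℕ) {W : Site d → Fin d → (Matrix n n ℂ)ˣ} (hW : IsUnitaryCfg W) (X : Matrix n n ℂ) (y : Site d) :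
    star (cbump2W M W X y) = cbump2W M W (star X) y := by
  rw [cbump2W_apply, cbump2W_apply, star_smul, star_trivial (tent M y ^ 2),
    star_Ad_of_unitary ((unitaryUnits _).inv_mem (btree_mem hW M _ _))]

/-- Skewness: a skew coefficient gives a skew field at a unitary background. [folklore] -/
theorem cbump2W_mem_skewAdjoint (M : ℕ) {W : Site d → Fin d → (Matrix n n ℂ)ˣ} (hW : IsUnitaryCfg W) {X : Matrix n n ℂ}
    (hX : X ∈ skewAdjoint (Matrix n n ℂ)) (y : Site d) : cbump2W M W X y ∈ skewAdjoint (Matrix n n ℂ) := by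
  rw [cbump2W_apply]
  exact skewAdjoint.smul_mem _ (Ad_mem_skewAdjoint ((unitaryUnits _).inv_mem (btree_mem hW M _ _)) hX)

/-- The norm: `‖cbump2W M W X y‖ = (tent M y)² · ‖X‖` (`W` unitary). [folklore] -/
theorem norm_cbump2W (M : ℕ) {W : Site d → Fin d → (Matrix n n ℂ)ˣ} (hW : IsUnitaryCfg W) (X : Matrix n n ℂ)
    (y : Site d) : ‖cbump2W M W X y‖ = tent M y ^ 2 * ‖X‖ := by
  rw [cbump2W_apply, norm_smul, Real.norm_of_nonneg (sq_nonneg _),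
    norm_Ad_of_unitary ((unitaryUnits _).inv_mem (btree_mem hW M _ _))]

/-- The sup: `‖cbump2W M W X y‖ ≤ ‖X‖` (`M ≥ 1`, `W` unitary; `tent ≤ 1`). [folklore] -/
theorem norm_cbump2W_le {M : ℕ} (hM : 1 ≤ M) {W : Site d → Fin d → (Matrix n n ℂ)ˣ} (hW : IsUnitaryCfg W) (X : Matrix n n ℂ)
    (y : Site d) : ‖cbump2W M W X y‖ ≤ ‖X‖ := by
  rw [norm_cbump2W M hW X y]
  have h1 : tent M y ^ 2 ≤ 1 := pow_le_one₀ (tent_nonneg hM y) (tent_le_one hM y)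
  exact (mul_le_mul_of_nonneg_right h1 (norm_nonneg _)).trans (by rw [one_mul])

/-- **ON THE BLOCK OF `z` A DRESSED SQUARED BUMP IS THE CONSTANT-COEFFICIENT ONE WITH COEFFICIENT `c z`** (`M ≥ 1`). [folklore] -/
theorem dressW_bump2_block {M : ℕ} (hM : 1 ≤ M) (W : Site d → Fin d → (Matrix n n ℂ)ˣ) (c : Site d → Matrix n n ℂ) (z : Site d)
    {v : Site d} (hv : v ∈ periodBox (d := d) M) :
    dressW M W (bump2 M c) ((M : ℤ) • z + v) = cbump2W M W (c z) ((M : ℤ) • z + v) := by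
  simp only [cbump2W, dressW, bump2, blk_block hM z hv]

/-- Periodicity: for `(M·N)`-periodic `W` the constant-coefficient squared bump field is `(M·N)`-periodic (`M ≥ 1`). [folklore] -/
theorem cbump2W_add_period {M : ℕ} (hM : 1 ≤ M) {N : ℕ} {W : Site d → Fin d → (Matrix n n ℂ)ˣ}
    (hWP : IsPeriodicCfg W ((M : ℤ) * N)) (X : Matrix n n ℂ) (y : Site d) (τ : Fin d) :
    cbump2W M W X (y + ((M * N : ℕ) : ℤ) • e τ) = cbump2W M W X y := by
  have hc : ((M * N : ℕ) : ℤ) = (M : ℤ) * (N : ℤ) := by push_cast; ring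
  have hbump : ∀ (x : Site d) (i : Fin d), bump2 M (fun _ => X) (x + ((M : ℤ) * N) • e i) = bump2 M (fun _ => X) x := by
    intro x i
    have h := bump2_add_period hM (N := N) (c := fun _ : Site d => X) (fun _ _ => rfl) x i
    rwa [hc] at h
  unfold cbump2W
  rw [hc, dressW_add_period hM hWP hbump]

/-! ## §2 The squared-tent mean and the exact single-scale part -/

/-- THE SQUARED-TENT MEAN `tentSum2 d M ∕ M^d` (`≥ 64^{−d}` for `M ≥ 2`). [folklore] -/
def tentMean2 (d M : ℕ) : ℝ := tentSum2 d M / ((M : ℝ) ^ d)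

/-- `0 < tentMean2` (`M ≥ 2`). [folklore] -/
theorem tentMean2_pos {M : ℕ} (hM : 2 ≤ M) (d : ℕ) : 0 < tentMean2 d M := by
  have : (0 : ℝ) < M := by exact_mod_cast (by omega : 0 < M)
  unfold tentMean2; exact div_pos (tentSum2_pos hM d) (by positivity)

/-- `64^{−d} ≤ tentMean2` (`M ≥ 2`). [folklore] -/
theorem inv_le_tentMean2 {M : ℕ} (hM : 2 ≤ M) (d : ℕ) : ((64 : ℝ) ^ d)⁻¹ ≤ tentMean2 d M := by
  have hM0 : (0 : ℝ) < (M : ℝ) ^ d := by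
    have : (0 : ℝ) < M := by exact_mod_cast (by omega : 0 < M)
    positivity
  unfold tentMean2
  rw [le_div_iff₀ hM0]
  calc ((64 : ℝ) ^ d)⁻¹ * (M : ℝ) ^ d = ((M : ℝ) / 64) ^ d := by rw [div_pow, div_eq_mul_inv, mul_comm]
    _ ≤ tentSum2 d M := le_tentSum2 hM d

/-- `tentMean2 ≤ 1` (`M ≥ 1`: the squared tent is at most `1`). [folklore] -/
theorem tentMean2_le_one {M : ℕ} (hM : 1 ≤ M) (d : ℕ) : tentMean2 d M ≤ 1 := by
  have hM0 : (0 : ℝ) < (M : ℝ) ^ d := by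
    have : (0 : ℝ) < M := by exact_mod_cast (by omega : 0 < M)
    positivity
  unfold tentMean2
  rw [div_le_one hM0, ← sum_block_tentSq (d := d) hM 0]
  calc ∑ v ∈ periodBox (d := d) M, tent M ((M : ℤ) • (0 : Site d) + v) ^ 2 ≤ ∑ _v ∈ periodBox (d := d) M, (1 : ℝ) :=
        Finset.sum_le_sum fun v _ => pow_le_one₀ (tent_nonneg hM _) (tent_le_one hM _)
    _ = (M : ℝ) ^ d := by rw [Finset.sum_const, card_periodBox]; simp

/-- **THE SINGLE-SCALE PART IS EXACT**: `bmeanW M W (cbump2W M W X) z = tentMean2 d M • X` (`M ≥ 1`). [folklore] -/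
theorem bmeanW_cbump2W {M : ℕ} (hM : 1 ≤ M) (W : Site d → Fin d → (Matrix n n ℂ)ˣ) (X : Matrix n n ℂ) (z : Site d) :
    bmeanW M W (cbump2W M W X) z = tentMean2 d M • X := by
  unfold cbump2W tentMean2
  rw [bmeanW_dressW, sum_block_bump2 hM, smul_smul, div_eq_inv_mul]

/-! ## §3 The near-scalar block operator of the squared bump -/

/-- **THE NEAR-SCALAR BLOCK OPERATOR** `Kop2 L j W z X := bmeanIterW L (j+1) W (cbump2W (L^(j+1)) W X) z − tentMean2 • X`, as an ℝ-linear map. [folklore] -/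
def Kop2 (L j : ℕ) (W : Site d → Fin d → (Matrix n n ℂ)ˣ) (z : Site d) : Matrix n n ℂ →ₗ[ℝ] Matrix n n ℂ where
  toFun X := bmeanIterW L (j + 1) W (cbump2W (L ^ (j + 1)) W X) z - tentMean2 d (L ^ (j + 1)) • X
  map_add' X Y := by
    rw [cbump2W_add, bmeanIterW_add, Pi.add_apply, smul_add]; abel
  map_smul' r X := by
    simp only [RingHom.id_apply]
    rw [cbump2W_smul, bmeanIterW_smul, Pi.smul_apply, smul_sub, smul_comm r]

/-- The value of `Kop2`. [folklore] -/
theorem Kop2_apply (L j : ℕ) (W : Site d → Fin d → (Matrix n n ℂ)ˣ) (z : Site d) (X : Matrix n n ℂ) :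
    Kop2 L j W z X = bmeanIterW L (j + 1) W (cbump2W (L ^ (j + 1)) W X) z - tentMean2 d (L ^ (j + 1)) • X := rfl

/-- **`Kop2` IS THE NESTED-MINUS-SINGLE-SCALE MEAN of the constant-coefficient squared bump** (`L ≥ 1`). [folklore] -/
theorem Kop2_eq_sub_bmeanW {L : ℕ} (hL : 1 ≤ L) (j : ℕ) (W : Site d → Fin d → (Matrix n n ℂ)ˣ) (z : Site d) (X : Matrix n n ℂ) :
    Kop2 L j W z X = bmeanIterW L (j + 1) W (cbump2W (L ^ (j + 1)) W X) z - bmeanW (L ^ (j + 1)) W (cbump2W (L ^ (j + 1)) W X) z := by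
  rw [Kop2_apply, bmeanW_cbump2W (Nat.one_le_pow _ _ hL)]

/-- **THE NEAR-SCALAR BOUND** (multi-level small-field class, `L ≥ 2`): `‖Kop2 L j W z X‖ ≤ E_j·tentMean2·‖X‖`, `E_j = 4d²(L^{j+1}−1)²x + 16d·loopRad(d,L,r_j)` — NE3-R2's
bridge applied to the squared bump, whose block mean of norms is `tentMean2·‖X‖`. [folklore] -/
theorem norm_Kop2_le [Nonempty n] {L : ℕ} (hL : 2 ≤ L) (j : ℕ) {W : Site d → Fin d → (Matrix n n ℂ)ˣ} {x : ℝ}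
    (hWu : IsUnitaryCfg W) (hx : 0 ≤ x) (hsm : LevelSmall d L j x) (hWx : SmallField W x) (z : Site d) (X : Matrix n n ℂ) :
    ‖Kop2 L j W z X‖
      ≤ (4 * (d : ℝ) ^ 2 * ((L : ℝ) ^ (j + 1) - 1) ^ 2 * x + 16 * d * loopRad d L ((prop1Radius d L)^[j] x))
        * tentMean2 d (L ^ (j + 1)) * ‖X‖ := by
  have hL1 : 1 ≤ L := by omega
  have hM1 : 1 ≤ L ^ (j + 1) := Nat.one_le_pow _ _ hL1
  rw [Kop2_eq_sub_bmeanW hL1]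
  refine (norm_bmeanIterW_sub_bmeanW_le hL j hWu hx hsm hWx _ z).trans (le_of_eq ?_)
  have hsum : ∑ v ∈ periodBox (d := d) (L ^ (j + 1)), ‖cbump2W (L ^ (j + 1)) W X ((((L ^ (j + 1) : ℕ) : ℤ)) • z + v)‖
      = tentSum2 d (L ^ (j + 1)) * ‖X‖ := by
    rw [Finset.sum_congr rfl fun v _ => norm_cbump2W _ hWu X _, ← Finset.sum_mul, sum_block_tentSq hM1]
  rw [hsum, tentMean2]
  push_cast
  ring

/-- `Kop2` commutes with `star` in the multi-level small-field class. [folklore] -/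
theorem star_Kop2 [Nonempty n] {L : ℕ} (hL : 1 ≤ L) (j : ℕ) {W : Site d → Fin d → (Matrix n n ℂ)ˣ} {x : ℝ}
    (hWu : IsUnitaryCfg W) (hx : 0 ≤ x) (hsm : LevelSmall d L j x) (hWx : SmallField W x) (z : Site d) (X : Matrix n n ℂ) :
    star (Kop2 L j W z X) = Kop2 L j W z (star X) := by
  rw [Kop2_apply, Kop2_apply, star_sub, star_smul, star_trivial (tentMean2 d (L ^ (j + 1))), star_bmeanIterW hL j hWu hx hsm hWx]
  have hfun : (fun y => star (cbump2W (L ^ (j + 1)) W X y)) = cbump2W (L ^ (j + 1)) W (star X) :=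
    funext fun y => star_cbump2W _ hWu X y
  rw [hfun]

/-- `Kop2` is the same linear map at `z` and `z + N•e_i` for `W` of period `tower L N (j+1)`. [folklore] -/
theorem Kop2_add_period {L : ℕ} (hL : 1 ≤ L) {N : ℕ} (j : ℕ) {W : Site d → Fin d → (Matrix n n ℂ)ˣ}
    (hWP : IsPeriodicCfg W ((tower L N (j + 1) : ℕ) : ℤ)) (z : Site d) (i : Fin d) :
    Kop2 L j W (z + (N : ℤ) • e i) = Kop2 L j W z := by
  have hM1 : 1 ≤ L ^ (j + 1) := Nat.one_le_pow _ _ hL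
  have htow : tower L N (j + 1) = L ^ (j + 1) * N := tower_eq_pow_mul L N (j + 1)
  have hWP' : IsPeriodicCfg W (((L ^ (j + 1) : ℕ) : ℤ) * N) := by
    have : (((L ^ (j + 1) : ℕ) : ℤ) * N) = ((tower L N (j + 1) : ℕ) : ℤ) := by rw [htow]; push_cast; ring
    rw [this]; exact hWP
  refine LinearMap.ext fun X => ?_
  rw [Kop2_apply, Kop2_apply]
  congr 1
  refine bmeanIterW_add_period' j hWP (F := cbump2W (L ^ (j + 1)) W X) (fun y i' => ?_) z i
  rw [htow]
  exact cbump2W_add_period hM1 hWP' X y i'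

end

end Summit.QuantumFields.BalabanUV.T4Continuum.NE7SquaredBumpNestedMeanOperator
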